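import Literature.AlgebraicGeometry.HodgeTheory.MaxRationalSubHodgeStructureKunnethAlgebraicCohomology
import Literature.AlgebraicGeometry.HodgeTheory.MaxRationalSubHodgeStructureKunnethLevelOne
import HarnessLib

/-!
# `GHC` and `HC` are symmetric in the factors of `X × Y`; the product theorems with the special factor on the
# left; surfaces with `q = p_g = 0` read through their Hodge numbers

Family `hodge`, layer `Literature/AlgebraicGeometry/HodgeTheory`; lane `lit-hodgefound` (Track 2 foundations,
Layer A1/A4). THEOREMS ONLY (no definition, no named fact; D-0026). Sequel of
`MaxRationalSubHodgeStructureKunnethAlgebraicCohomology` (`HC(X × Y) ⟺ HC(X)`, `GHC(X × Y, k, r) ⟸ ∧_b GHC(X, k − 2b, r − b)`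
for `Y` with algebraic cohomology, always with the special factor `Y` on the RIGHT) and
`MaxRationalSubHodgeStructureKunnethLevelOne` (surfaces with `p_g = 0`).

Sources, VERBATIM. A. Grothendieck, *Hodge's general conjecture is false for trivial reasons*, Topology 8 (1969),
p. 300 («the largest sub-space of [`Fʳ Hᵏ ∩ Hᵏ(X, ℚ)`], generating a subspace of `Hᵏ(X^an, ℂ)` which is a sub-Hodge
structure»). D. Arapura, *Motivation for Hodge cycles*, Adv. Math. 207 (2006), §4 Lemma 4.2 — `GHC`, `HC` descend
along surjective morphisms (the tree's `generalHodgePropertyFor_of_surjective`,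
`SurjectiveDescent.hodgeConjectureFor_of_surjective`), applied here to the BRAIDING ISOMORPHISM
`β : X × Y ≅ Y × X` of the cartesian monoidal structure. C. Voisin, *Hodge Theory and Complex Algebraic Geometry I*
(CUP 2002), §6.1.3 Cor. 6.12/6.14 (`b₁ = 2 h^{1,0}`, the tree's `finrank_complexBetti_one_eq_two_mul_finrank_hodgeOneZero`)
and Thm. 6.25 (hard Lefschetz `L : H¹(S) ≅ H³(S)` on a surface, the tree's `KaehlerRationalDatum.hasHardLefschetzProperty`).

## What is proved

* §1 **`generalHodgePropertyFor_tensor_comm`**, **`hodgeConjectureFor_tensor_comm`** — `GHC(X × Y, k, r) ⟺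
  GHC(Y × X, k, r)`, `HC(X × Y) ⟺ HC(Y × X)` (the braiding is an isomorphism, hence surjective both ways).
* §2 The product theorems with the special factor on the LEFT: `hodgeConjectureFor_tensor_iff_of_forall_algebraic_left`
  (`HC(Y × X) ⟺ HC(X)` for `Y` with algebraic cohomology), `hodgeConjectureFor_projectiveSpace_tensor_iff`
  (`HC(ℙˢ × X) ⟺ HC(X)`), `generalHodgePropertyFor_tensor_of_forall_algebraic_left`,
  `generalHodgePropertyFor_projectiveLine_tensor_iff` (`GHC(ℙ¹ × X, k + 2, r + 1) ⟺ GHC(X, k + 2, r + 1) ∧ GHC(X, k, r)`),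
  `generalHodgePropertyFor_curve_tensor_surface` (`GHC(C × S, i, r)` for all `(i, r)`, `p_g(S) = 0`).
* §3 Surfaces through their Hodge numbers: `subsingleton_complexBetti_one_of_finrank_hodgeOneZero_eq_zero`
  (`q(X) = 0 ⟹ H¹(X(ℂ); ℂ) = 0`), `subsingleton_complexBetti_three_of_surface` (`H¹(S) = 0 ⟹ H³(S) = 0` on a surface,
  hard Lefschetz), and the restatements **`hodgeConjectureFor_tensor_surface_iff_of_irregularity_geometricGenus_eq_zero`**
  (`q(S) = p_g(S) = 0 ⟹ (HC(X × S) ⟺ HC(X))`),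
  **`generalHodgePropertyFor_tensor_surface_of_irregularity_geometricGenus_eq_zero`**
  (`GHC(X, k, r) ∧ GHC(X, k − 2, r − 1) ∧ GHC(X, k − 4, r − 2) ⟹ GHC(X × S, k, r)`) and
  **`generalHodgePropertyFor_surface_tensor_level_one_iff_of_irregularity_geometricGenus_eq_zero`**
  (`GHC(S × Y, k, 1) ⟺ GHC(Y, k, 1)`).

## References

* [GrothendieckTopology1969] A. Grothendieck, Hodge's general conjecture is false for trivial reasons, Topology 8
  (1969) 299–303, pp. 300–301.
* [Arapura2006] D. Arapura, Motivation for Hodge cycles, Adv. Math. 207 (2006), §4 Lemma 4.2 and §1 Cor. 1.2.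
* [VoisinHodgeI2002] C. Voisin, Hodge Theory and Complex Algebraic Geometry I (CUP 2002), §6.1.3 Cor. 6.12 and
  Cor. 6.14, Thm. 6.25, §11.3.3 Thm. 11.38.
* [CarlsonMullerStachPeters2017] J. Carlson, S. Müller-Stach, C. Peters, Period Mappings and Period Domains,
  2nd ed. (CUP 2017), §3.4 Examples 3.4.5 (i).
-/

noncomputable section

open CategoryTheory AlgebraicGeometry MonoidalCategory CartesianMonoidalCategory Finset
open Literature.AlgebraicTopology.SingularHomology
open Literature.Geometry.Kaehler
open Literature.AlgebraicGeometry.Motives (IsSmoothProjective ComplexPoints)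

namespace Literature.AlgebraicGeometry.HodgeTheory

variable {n m : ℕ} {X Y : Motives.SchemeOver ℂ}

/-! ### §1 Symmetry in the factors -/

/-- The underlying scheme morphism of the braiding `β : X ⊗ Y ≅ Y ⊗ X` is an isomorphism. [cite: Arapura2006, §4 Lemma 4.2] -/
theorem isIso_braiding_hom_left (X Y : Motives.SchemeOver ℂ) : IsIso (β_ X Y).hom.left :=
  (inferInstance : IsIso ((Over.forget _).mapIso (β_ X Y)).hom)

/-- **`GHC(X × Y, k, r) ⟹ GHC(Y × X, k, r)`** (descent of `GHC` along the surjective braiding isomorphism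
`X × Y ⟶ Y × X`, `generalHodgePropertyFor_of_surjective`). [cite: Arapura2006, §4 Lemma 4.2]
[cite: GrothendieckTopology1969, p. 300] -/
theorem GeneralHodgePropertyFor.tensor_comm (hX : IsSmoothProjective n X) (hY : IsSmoothProjective m Y) {k r : ℕ}
    (h : GeneralHodgePropertyFor (n + m) (X ⊗ Y) k r) : GeneralHodgePropertyFor (m + n) (Y ⊗ X) k r := by
  haveI := isIso_braiding_hom_left X Y
  haveI : Surjective (β_ X Y).hom.left := inferInstance
  exact generalHodgePropertyFor_of_surjective (hX.tensor_holds hY) (hY.tensor_holds hX) (β_ X Y).hom h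

/-- **`GHC(X × Y, k, r) ⟺ GHC(Y × X, k, r)`.** [cite: Arapura2006, §4 Lemma 4.2] [cite: GrothendieckTopology1969, p. 300] -/
theorem generalHodgePropertyFor_tensor_comm (hX : IsSmoothProjective n X) (hY : IsSmoothProjective m Y) (k r : ℕ) :
    GeneralHodgePropertyFor (n + m) (X ⊗ Y) k r ↔ GeneralHodgePropertyFor (m + n) (Y ⊗ X) k r :=
  ⟨fun h ↦ h.tensor_comm hX hY, fun h ↦ h.tensor_comm hY hX⟩

/-- **`HC(X × Y) ⟹ HC(Y × X)`** (descent of `HC` along the braiding, `SurjectiveDescent.hodgeConjectureFor_of_surjective`).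
[cite: Arapura2006, §4 Lemma 4.2 and §1 Cor. 1.2] -/
theorem hodgeConjectureFor_tensor_comm_mp (hX : IsSmoothProjective n X) (hY : IsSmoothProjective m Y)
    (h : HodgeConjectureFor (n + m) (X ⊗ Y)) : HodgeConjectureFor (m + n) (Y ⊗ X) := by
  haveI := isIso_braiding_hom_left X Y
  haveI : Surjective (β_ X Y).hom.left := inferInstance
  exact SurjectiveDescent.hodgeConjectureFor_of_surjective (hX.tensor_holds hY) (hY.tensor_holds hX) (β_ X Y).hom h

/-- **`HC(X × Y) ⟺ HC(Y × X)`.** [cite: Arapura2006, §4 Lemma 4.2 and §1 Cor. 1.2] -/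
theorem hodgeConjectureFor_tensor_comm (hX : IsSmoothProjective n X) (hY : IsSmoothProjective m Y) :
    HodgeConjectureFor (n + m) (X ⊗ Y) ↔ HodgeConjectureFor (m + n) (Y ⊗ X) :=
  ⟨hodgeConjectureFor_tensor_comm_mp hX hY, hodgeConjectureFor_tensor_comm_mp hY hX⟩

/-! ### §2 The product theorems with the special factor on the left -/

/-- **`HC(Y × X) ⟺ HC(X)` for `Y` with algebraic cohomology** (on the left).
[cite: GrothendieckTopology1969, pp. 300–301] [cite: Arapura2006, §4 Lemma 4.2]
[cite: CarlsonMullerStachPeters2017, §3.4 Examples 3.4.5 (i)] -/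
theorem hodgeConjectureFor_tensor_iff_of_forall_algebraic_left (hY : IsSmoothProjective m Y)
    (hX : IsSmoothProjective n X) (hodd : ∀ j : ℕ, Odd j → Subsingleton (complexBetti Y j))
    (halg : ∀ b : ℕ, supportedClasses Y (2 * b) b = ⊤) :
    HodgeConjectureFor (m + n) (Y ⊗ X) ↔ HodgeConjectureFor n X := by
  rw [← hodgeConjectureFor_tensor_comm hX hY]
  exact hodgeConjectureFor_tensor_iff_of_forall_algebraic hX hY hodd halg

/-- **`HC(ℙˢ × X) ⟺ HC(X)`.** [cite: CarlsonMullerStachPeters2017, §3.4 Examples 3.4.5 (i)]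
[cite: GrothendieckTopology1969, pp. 300–301] -/
theorem hodgeConjectureFor_projectiveSpace_tensor_iff (s : ℕ) (hX : IsSmoothProjective n X) :
    HodgeConjectureFor (s + n) (Motives.projectiveSpace s ℂ ⊗ X) ↔ HodgeConjectureFor n X := by
  rw [← hodgeConjectureFor_tensor_comm hX (isSmoothProjective_projectiveSpace' s)]
  exact hodgeConjectureFor_tensor_projectiveSpace_iff hX s

/-- **`GHC(Y × X, k, r)` from `GHC(X, k − 2b, r − b)`, `b ≤ m`, `2b ≤ k`, for `Y` with algebraic cohomology** (on the
left). [cite: GrothendieckTopology1969, p. 300] [cite: Arapura2006, §4 Lemma 4.2] -/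
theorem generalHodgePropertyFor_tensor_of_forall_algebraic_left (hY : IsSmoothProjective m Y)
    (hX : IsSmoothProjective n X) (hodd : ∀ j : ℕ, Odd j → Subsingleton (complexBetti Y j))
    (halg : ∀ b : ℕ, supportedClasses Y (2 * b) b = ⊤) {k r : ℕ}
    (h : ∀ b : ℕ, b ≤ m → 2 * b ≤ k → GeneralHodgePropertyFor n X (k - 2 * b) (r - b)) :
    GeneralHodgePropertyFor (m + n) (Y ⊗ X) k r :=
  (generalHodgePropertyFor_tensor_of_forall_algebraic hX hY hodd halg h).tensor_comm hX hY

/-- **`GHC(ℙ¹ × X, k + 2, r + 1) ⟺ GHC(X, k + 2, r + 1) ∧ GHC(X, k, r)`.** [cite: GrothendieckTopology1969, p. 300]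
[cite: Arapura2006, §4 Lemma 4.2] -/
theorem generalHodgePropertyFor_projectiveLine_tensor_iff (hX : IsSmoothProjective n X) (k r : ℕ) :
    GeneralHodgePropertyFor (1 + n) (Motives.projectiveSpace 1 ℂ ⊗ X) (k + 2) (r + 1) ↔
      GeneralHodgePropertyFor n X (k + 2) (r + 1) ∧ GeneralHodgePropertyFor n X k r := by
  rw [← generalHodgePropertyFor_tensor_comm hX (isSmoothProjective_projectiveSpace' 1)]
  exact generalHodgePropertyFor_tensor_projectiveLine_iff hX k r

/-- **`GHC(C × S, i, r)` in every bidegree for a curve `C` and a surface `S` with `N¹ H²(S) = H²(S)`** (curve on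
the left; the prequel's `generalHodgePropertyFor_surface_tensor_curve`). [cite: GrothendieckTopology1969, p. 300]
[cite: Arapura2006, §4 Lemma 4.2] -/
theorem generalHodgePropertyFor_curve_tensor_surface {C S : Motives.SchemeOver ℂ} (hC : IsSmoothProjective 1 C)
    (hS : IsSmoothProjective 2 S) (hS2 : supportedClasses S 2 1 = ⊤) (i r : ℕ) :
    GeneralHodgePropertyFor 3 (C ⊗ S) i r :=
  (generalHodgePropertyFor_surface_tensor_curve hS hC hS2 i r).tensor_comm hS hC

/-! ### §3 Surfaces with `q = p_g = 0`, read through their Hodge numbers -/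

/-- **`q(X) = 0 ⟹ H¹(X(ℂ); ℂ) = 0`**: `b₁ = 2 h^{1,0}` (the tree's
`finrank_complexBetti_one_eq_two_mul_finrank_hodgeOneZero`). [cite: VoisinHodgeI2002, §6.1.3 Cor. 6.12 and Cor. 6.14] -/
theorem subsingleton_complexBetti_one_of_finrank_hodgeOneZero_eq_zero (hX : IsSmoothProjective n X)
    (hq : Module.finrank ℂ ↥(hodgeOneZero hX) = 0) : Subsingleton (complexBetti X 1) := by
  haveI := finite_complexBetti hX 1
  have h := finrank_complexBetti_one_eq_two_mul_finrank_hodgeOneZero hX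
  rw [hq, mul_zero] at h
  exact Module.finrank_zero_iff.1 h

/-- **`H¹(S(ℂ); ℂ) = 0 ⟹ H³(S(ℂ); ℂ) = 0` on a smooth projective surface** (hard Lefschetz: `L_η : H¹ → H³` is
bijective for the rational Kähler class of a `KaehlerRationalDatum`). [cite: VoisinHodgeI2002, Thm. 6.25] -/
theorem subsingleton_complexBetti_three_of_surface {S : Motives.SchemeOver ℂ} (hS : IsSmoothProjective 2 S)
    [Subsingleton (complexBetti S 1)] : Subsingleton (complexBetti S 3) := by
  obtain ⟨D⟩ := nonempty_kaehlerRationalDatum hS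
  refine ⟨fun a b ↦ ?_⟩
  obtain ⟨x, rfl⟩ := (D.hasHardLefschetzProperty hS 1 1 rfl).2 a
  obtain ⟨y, rfl⟩ := (D.hasHardLefschetzProperty hS 1 1 rfl).2 b
  rw [Subsingleton.elim x y]

/-- **`q(S) = p_g(S) = 0 ⟹ (HC(X × S) ⟺ HC(X))`** for a smooth projective surface `S` and every smooth projective `X`
(`q = dim H^{1,0}`, `p_g` read as `h^{0,2}` of the lane's Hodge structure on `H²(S; ℚ)`).
[cite: GrothendieckTopology1969, pp. 300–301] [cite: VoisinHodgeI2002, §6.1.3 Cor. 6.12, Thm. 6.25 and Thm. 11.30]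
[cite: Arapura2006, §4 Lemma 4.2] -/
theorem hodgeConjectureFor_tensor_surface_iff_of_irregularity_geometricGenus_eq_zero {S : Motives.SchemeOver ℂ}
    (hHD : exists_isReal_hodgeModel) (hX : IsSmoothProjective n X) (hS : IsSmoothProjective 2 S)
    (hq : Module.finrank ℂ ↥(hodgeOneZero hS) = 0) (hpg : (BettiUniverse.hodge hHD hS 2).hodgeNumber 0 2 = 0) :
    HodgeConjectureFor (n + 2) (X ⊗ S) ↔ HodgeConjectureFor n X := by
  haveI := subsingleton_complexBetti_one_of_finrank_hodgeOneZero_eq_zero hS hq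
  haveI := subsingleton_complexBetti_three_of_surface hS
  exact hodgeConjectureFor_tensor_surface_iff_of_algebraic hX hS
    (supportedClasses_two_one_eq_top_of_hodgeNumber_zero_two hHD hS hpg)

/-- **`q(S) = p_g(S) = 0`: `GHC(X, k, r) ∧ GHC(X, k − 2, r − 1) ∧ GHC(X, k − 4, r − 2) ⟹ GHC(X × S, k, r)`.**
[cite: GrothendieckTopology1969, p. 300] [cite: VoisinHodgeI2002, §6.1.3 Cor. 6.12, Thm. 6.25 and Thm. 11.30] -/
theorem generalHodgePropertyFor_tensor_surface_of_irregularity_geometricGenus_eq_zero {S : Motives.SchemeOver ℂ}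
    (hHD : exists_isReal_hodgeModel) (hX : IsSmoothProjective n X) (hS : IsSmoothProjective 2 S)
    (hq : Module.finrank ℂ ↥(hodgeOneZero hS) = 0) (hpg : (BettiUniverse.hodge hHD hS 2).hodgeNumber 0 2 = 0)
    {k r : ℕ} (h0 : GeneralHodgePropertyFor n X k r) (h1 : GeneralHodgePropertyFor n X (k - 2) (r - 1))
    (h2 : GeneralHodgePropertyFor n X (k - 4) (r - 2)) : GeneralHodgePropertyFor (n + 2) (X ⊗ S) k r := by
  haveI := subsingleton_complexBetti_one_of_finrank_hodgeOneZero_eq_zero hS hq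
  haveI := subsingleton_complexBetti_three_of_surface hS
  exact generalHodgePropertyFor_tensor_surface_of_algebraic hX hS
    (supportedClasses_two_one_eq_top_of_hodgeNumber_zero_two hHD hS hpg) h0 h1 h2

/-- **`q(S) = p_g(S) = 0`: `GHC(S × Y, k, 1) ⟺ GHC(Y, k, 1)`** for every smooth projective `Y`.
[cite: GrothendieckTopology1969, p. 300] [cite: VoisinHodgeI2002, §6.1.3 Cor. 6.12 and Thm. 11.30] -/
theorem generalHodgePropertyFor_surface_tensor_level_one_iff_of_irregularity_geometricGenus_eq_zero
    {S : Motives.SchemeOver ℂ} (hHD : exists_isReal_hodgeModel) (hS : IsSmoothProjective 2 S)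
    (hY : IsSmoothProjective m Y) (hq : Module.finrank ℂ ↥(hodgeOneZero hS) = 0)
    (hpg : (BettiUniverse.hodge hHD hS 2).hodgeNumber 0 2 = 0) (k : ℕ) :
    GeneralHodgePropertyFor (2 + m) (S ⊗ Y) k 1 ↔ GeneralHodgePropertyFor m Y k 1 := by
  haveI := subsingleton_complexBetti_one_of_finrank_hodgeOneZero_eq_zero hS hq
  exact generalHodgePropertyFor_surface_tensor_level_one_iff_of_hodgeNumber_eq_zero hHD hS hY hpg k

/-- **`q(S) = p_g(S) = 0 ⟹ (HC(S × X) ⟺ HC(X))`** (surface on the left). [cite: GrothendieckTopology1969, pp. 300–301]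
[cite: Arapura2006, §4 Lemma 4.2] -/
theorem hodgeConjectureFor_surface_tensor_iff_of_irregularity_geometricGenus_eq_zero {S : Motives.SchemeOver ℂ}
    (hHD : exists_isReal_hodgeModel) (hS : IsSmoothProjective 2 S) (hX : IsSmoothProjective n X)
    (hq : Module.finrank ℂ ↥(hodgeOneZero hS) = 0) (hpg : (BettiUniverse.hodge hHD hS 2).hodgeNumber 0 2 = 0) :
    HodgeConjectureFor (2 + n) (S ⊗ X) ↔ HodgeConjectureFor n X := by
  rw [← hodgeConjectureFor_tensor_comm hX hS]
  exact hodgeConjectureFor_tensor_surface_iff_of_irregularity_geometricGenus_eq_zero hHD hX hS hq hpg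

end Literature.AlgebraicGeometry.HodgeTheory

end
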